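import Summits.NavierStokesRegularity.FunctionalMining.PalinstrophyLadder
import Summits.NavierStokesRegularity.FunctionalMining.PalinstrophyRates
import HarnessLib

/-!
# Functional mining NO-GO N6 (statement): the unlogged palinstrophy / sup-vorticity rate bound fails for every constant

Search for candidate a priori estimates; no regularity claim.

Cell `pub-nsfunc` (host summit NavierStokesRegularity, topic `FunctionalMining`), NO-GO branch, gen 3.
Statements (§§1–2) written by the no-go seat (`pub-nsfunc-nogo/NoGo/PalinstrophySupRate.STAGING.lean`,
paper-level proof of N6 in `pub-nsfunc-nogo/LOGDOOR.md` §1: Lemma A = exact trigonometric-polynomial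
packet expansion; Lemma B = corner strain of the Poisson-smoothed checkerboard,
`Σ_{m,n odd} e^{−2π(m+n)δ}/(m²+n²) → ∞`), filed verbatim by the prove seat together with the
dynamic ⇒ static reductions of §3 (prove seat, gen 3): the dictionary's K1-Q3 STATIC CRITERION
`PalinstrophyLogBudget.static` (a logged budget with constants `C, c` forces, at every smooth
divergence-free datum with `|ω| ≤ M`, `2N − 2νD₃ ≤ C M 𝒫 log(e + c𝒫/ν²)` — the door through which both a
witness and a proof must pass), and the amplitude-ray reduction
`palinstrophySupRateBound_of_rateSupBound : PalinstrophyRateSupBound C → PalinstrophySupRateBound (C/2)`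
(so `PalinstrophySupRateFails → PalinstrophyRateSupFails`: the static N6 kills the dynamic row), both from
the tree's local existence `Torus.exists_classicalNS_smooth` and the `H²` balance
`torusPalinstrophy_hasDerivWithinAt`.

Dictionary row `EF.s=2 | T_C | C1` of K0 ("control", holder-note "may be +∞ by a log"):
`d𝒫/dt ≤ C‖ω‖_∞ 𝒫` with `𝒫 = torusPalinstrophy = ∫‖Δu‖²`. By the amplitude ray (NOGO N2; the pattern of
`palinstrophy_rate_ray_le_budget`) the dynamic row with constant `C` forces the STATIC field inequality
`−∫⟪(v·∇)v, Δ²v⟫ ≤ (C/2)·M·∫‖Δv‖²` at every smooth divergence-free zero-mean `v` with `|ω_v| ≤ M`;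
Theorem N6 says the static inequality fails for EVERY real constant (planar corner-strain + packet
family: the ratio production/(‖ω‖_∞·𝒫) is `≥ (2/π)log(1/δ) − O(1)`), so the row fails for every `C`
and the log door (T_CL, j = 1: `PalinstrophyLogBudget`) is necessary, not optional.

* `PalinstrophySupRateBound C` — static form (pattern of `StretchingSupBound`);
* `PalinstrophyRateSupBound C` — dynamic form (pattern of `EnstrophyRateSupBound`, = `PalinstrophyLogBudget`
  with the logarithm replaced by `1` and `ν ≥ 0`);
* `PalinstrophySupRateFails` — **N6**: `∀ C, ¬ PalinstrophySupRateBound C` (conjecture-tagged = to be proved;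
  paper-level proof complete);
* `palinstrophySupRateBound_mono`, `palinstrophyRateSupBound_mono` — bookkeeping;
* §3 (proved): `torusVorticitySqAt_amplitude`, `palinstrophyProduction_amplitude`,
  `palinstrophyDissipation_amplitude`, `torusPalinstrophy_amplitude` (degrees `2, 3, 2, 2` along
  amplitude rays), `PalinstrophyLogBudget.static`, `PalinstrophyRateSupBound.static`,
  `palinstrophySupRateBound_of_rateSupBound`, `palinstrophyRateSupFails_of_supRateFails`.
-/

noncomputable section

open Set MeasureTheory
open scoped InnerProductSpace RealInnerProductSpace

namespace Summit.NavierStokesRegularity.FunctionalMining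

open Literature.Analysis.FunctionSpaces Literature.Analysis.FluidPDE

variable {d : Type*} [Fintype d] [DecidableEq d]

/-- **STATIC unlogged palinstrophy / sup-vorticity bound with constant `C`:** on `T³`, for every smooth
divergence-free `v` and every pointwise majorant `M ≥ 0` of `|ω|` (`torusVorticitySqAt v x ≤ M²`), the
palinstrophy production `−∫⟪(v·∇)v, Δ²v⟫` is at most `C·M·∫‖Δv‖²`. Pattern of `StretchingSupBound`; the
enstrophy analogue holds with `C = 2` (Doering–Gibbon), this one holds for NO `C` (N6,
`PalinstrophySupRateFails`). Search for candidate a priori estimates; no regularity claim — nothing is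
asserted. -/
def PalinstrophySupRateBound (C : ℝ) : Prop :=
  Fintype.card d = 3 → ∀ v : UnitAddTorus d → EuclideanSpace ℝ d,
    Torus.IsSmooth v → Torus.IsDivFree v →
      ∀ M : ℝ, 0 ≤ M → (∀ x, torusVorticitySqAt v x ≤ M ^ 2) →
        -∫ x, ⟪Torus.convect v v x, Torus.laplacian (Torus.laplacian v) x⟫ ≤
          C * M * torusPalinstrophy v

/-- The static bound is monotone in the constant. [folklore] -/
theorem palinstrophySupRateBound_mono {C C' : ℝ} (hCC' : C ≤ C') (h : PalinstrophySupRateBound (d := d) C) :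
    PalinstrophySupRateBound (d := d) C' := by
  intro hd v hv hdiv M hM hω
  have hP : 0 ≤ torusPalinstrophy v := by
    unfold torusPalinstrophy; positivity
  calc -∫ x, ⟪Torus.convect v v x, Torus.laplacian (Torus.laplacian v) x⟫ ≤ C * M * torusPalinstrophy v :=
        h hd v hv hdiv M hM hω
    _ ≤ C' * M * torusPalinstrophy v := by gcongr

/-- **DYNAMIC unlogged row `EF.s=2 | T_C | C1` with constant `C`:** along every classical solution of
unforced Navier–Stokes/Euler (`ν ≥ 0`) on `T³ × [a, b]`, every one-sided derivative value `R` of the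
palinstrophy at a time where `|ω| ≤ M` pointwise satisfies `R ≤ C M 𝒫`. This is `PalinstrophyLogBudget C c`
with the logarithmic factor replaced by `1` (and `ν = 0` allowed). Nothing is asserted. -/
def PalinstrophyRateSupBound (C : ℝ) : Prop :=
  Fintype.card d = 3 → ∀ {ν : ℝ}, 0 ≤ ν → ∀ {a b : ℝ}, a < b →
    ∀ {u : ℝ → UnitAddTorus d → EuclideanSpace ℝ d} {p : ℝ → UnitAddTorus d → ℝ},
      Torus.IsClassicalNSSolutionOn (Icc a b) ν 0 u p →
      ∀ t ∈ Icc a b, ∀ M : ℝ, 0 ≤ M → (∀ x, torusVorticitySqAt (u t) x ≤ M ^ 2) →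
        ∀ R : ℝ, HasDerivWithinAt (fun s => torusPalinstrophy (u s)) R (Icc a b) t →
          R ≤ C * M * torusPalinstrophy (u t)

/-- The dynamic bound is monotone in the constant. [folklore] -/
theorem palinstrophyRateSupBound_mono {C C' : ℝ} (hCC' : C ≤ C') (h : PalinstrophyRateSupBound (d := d) C) :
    PalinstrophyRateSupBound (d := d) C' := by
  intro hd ν hν a b hab u p hsol t ht M hM hω R hR
  have hP : 0 ≤ torusPalinstrophy (u t) := by
    unfold torusPalinstrophy; positivity
  calc R ≤ C * M * torusPalinstrophy (u t) := h hd hν hab hsol t ht M hM hω R hR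
    _ ≤ C' * M * torusPalinstrophy (u t) := by gcongr

/-- A logged budget with nonnegative constants dominates the unlogged one with the same `C`:
`PalinstrophyRateSupBound C → PalinstrophyLogBudget C c` for `C, c ≥ 0` (`log(e + x) ≥ 1` for `x ≥ 0`).
So N6 below is exactly the statement that the log door cannot be shut. [folklore] -/
theorem palinstrophyLogBudget_of_rateSupBound {C c : ℝ} (hC : 0 ≤ C) (hc : 0 ≤ c)
    (h : PalinstrophyRateSupBound (d := d) C) : PalinstrophyLogBudget (d := d) C c := by
  intro hd ν hν a b hab u p hsol t ht M hM hω R hR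
  have hP : 0 ≤ torusPalinstrophy (u t) := by
    unfold torusPalinstrophy; positivity
  have h1 := h hd hν.le hab hsol t ht M hM hω R hR
  have hlog : 1 ≤ Real.log (Real.exp 1 + c * torusPalinstrophy (u t) / ν ^ 2) := by
    have h0 : 0 ≤ c * torusPalinstrophy (u t) / ν ^ 2 := by positivity
    have h2 : Real.exp 1 ≤ Real.exp 1 + c * torusPalinstrophy (u t) / ν ^ 2 := le_add_of_nonneg_right h0
    calc (1 : ℝ) = Real.log (Real.exp 1) := (Real.log_exp 1).symm
      _ ≤ Real.log (Real.exp 1 + c * torusPalinstrophy (u t) / ν ^ 2) :=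
          Real.log_le_log (Real.exp_pos 1) h2
  calc R ≤ C * M * torusPalinstrophy (u t) := h1
    _ = C * M * torusPalinstrophy (u t) * 1 := (mul_one _).symm
    _ ≤ C * M * torusPalinstrophy (u t) * Real.log (Real.exp 1 + c * torusPalinstrophy (u t) / ν ^ 2) := by
        have : 0 ≤ C * M * torusPalinstrophy (u t) := by positivity
        exact mul_le_mul_of_nonneg_left hlog this

/-- **N6 (nogo seat gen 3; paper-level proof `pub-nsfunc-nogo/LOGDOOR.md` §1, UNREVIEWED): the static
unlogged palinstrophy / sup-vorticity bound fails for every real constant.** Witness family (planar, lifted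
to `T³`): `ω = ω_δ + a·φ·cos(2πKy)` with `ω_δ(x,y) = F_δ(x)F_δ(y)`, `F_δ` the Poisson-smoothed square wave,
`φ` a Fejér bump at the corner; exact packet expansion (Lemma A) gives production/𝒫 → ⟨−ψ_{δ,xy}⟩_{φ²}` as
`K → ∞`, and the corner strain `−ψ_{δ,xy}(0) = (16/π²)Σ_{m,n odd} e^{−2π(m+n)δ}/(m²+n²) ≥ c·log(1/δ) − C₀`
(Lemma B) is unbounded while `|ω| ≤ 1 + a`. For `C ≤ 0` the three-wave field already refutes it
(`production2_w`). Conjecture-tagged = expected provable; nothing is asserted. -/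
@[conjecture] def PalinstrophySupRateFails : Prop :=
  ∀ C : ℝ, ¬ PalinstrophySupRateBound (d := d) C

/-- **N6, dynamic reading (row `EF.s=2|T_C|C1` dead for every `C`).** Follows from
`PalinstrophySupRateFails` by `palinstrophyRateSupFails_of_supRateFails` (§3: the amplitude ray `A • w`,
`A → ∞`, at `ν = 1` and the tree's local existence: `PalinstrophyRateSupBound C` at the datum `A • w`,
`t = 0` reads `2A³N(w) − 2A²D₃(w) ≤ C·(A M)·A²𝒫(w)`, i.e. `2N(w) ≤ C M 𝒫(w) + 2D₃(w)/A` for all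
`A > 0`, whence the static bound with constant `C/2`). Conjecture-tagged; nothing is asserted. -/
@[conjecture] def PalinstrophyRateSupFails : Prop :=
  ∀ C : ℝ, ¬ PalinstrophyRateSupBound (d := d) C

/-! ## §3. Dynamic ⇒ static (prove seat, gen 3): the K1-Q3 static criterion and the amplitude ray -/

/-- `|ω(c v)|² = c² |ω(v)|²` pointwise, for `C¹` fields (`∂ᵢ(c v) = c ∂ᵢv`). [folklore] -/
theorem torusVorticitySqAt_amplitude {v : UnitAddTorus d → EuclideanSpace ℝ d}
    (hv : Torus.IsContDiff 1 v) (c : ℝ) (x : UnitAddTorus d) :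
    torusVorticitySqAt (c • v) x = c ^ 2 * torusVorticitySqAt v x := by
  unfold torusVorticitySqAt
  simp only [Torus.partialDeriv_const_smul hv c, Pi.smul_apply, PiLp.smul_apply, smul_eq_mul]
  have h : ∀ i j, (c * (Torus.partialDeriv i v x) j - c * (Torus.partialDeriv j v x) i) ^ 2 =
      c ^ 2 * (((Torus.partialDeriv i v x) j - (Torus.partialDeriv j v x) i) ^ 2) := fun i j => by
    ring
  simp only [h, ← Finset.mul_sum]
  ring

omit [DecidableEq d] in
/-- The palinstrophy production is cubic along amplitude rays: `N(c v) = c³ N(v)`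
(`palinstrophyProduction_const_smul` of `PalinstrophyRates`, in the vocabulary of
`PalinstrophyLadder`). [folklore] -/
theorem palinstrophyProduction_amplitude {v : UnitAddTorus d → EuclideanSpace ℝ d}
    (hv : Torus.IsSmooth v) (c : ℝ) :
    palinstrophyProduction (c • v) = c ^ 3 * palinstrophyProduction v :=
  palinstrophyProduction_const_smul hv c

/-- The palinstrophy dissipation is quadratic along amplitude rays: `D₃(c v) = c² D₃(v)`. [folklore] -/
theorem palinstrophyDissipation_amplitude {v : UnitAddTorus d → EuclideanSpace ℝ d}
    (hv : Torus.IsSmooth v) (c : ℝ) :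
    palinstrophyDissipation (c • v) = c ^ 2 * palinstrophyDissipation v :=
  gradNormSq_laplacian_const_smul hv c

omit [DecidableEq d] in
/-- The palinstrophy is quadratic along amplitude rays: `𝒫(c v) = c² 𝒫(v)`. [folklore] -/
theorem torusPalinstrophy_amplitude {v : UnitAddTorus d → EuclideanSpace ℝ d}
    (hv : Torus.IsSmooth v) (c : ℝ) :
    torusPalinstrophy (c • v) = c ^ 2 * torusPalinstrophy v :=
  laplacianNormSq_const_smul hv c

/-- **K1-Q3 STATIC CRITERION (dynamic ⇒ static for the log door; dictionary ask, DICTIONARY N10).**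
If `PalinstrophyLogBudget C c` holds on `T³`, then for every `ν > 0`, every smooth divergence-free
field `w` and every pointwise vorticity majorant `M ≥ 0` (`|ω_w|² ≤ M²`):
`2N(w) − 2νD₃(w) ≤ C · M · 𝒫(w) · log(e + c𝒫(w)/ν²)`
(`N = palinstrophyProduction`, `D₃ = palinstrophyDissipation`, `𝒫 = torusPalinstrophy`). Proof: the
budget at `t = 0` along the local classical solution issued from `w`
(`Torus.exists_classicalNS_smooth`), whose palinstrophy has one-sided derivative `2N − 2νD₃` there
(`torusPalinstrophy_hasDerivWithinAt`). This is the door both the no-go seat's two-scale witness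
(threshold kill for small `C`) and any proof of K1-Q3(a) must pass; applied to the data `A • w` it
gives the whole amplitude family `2A³N − 2νA²D₃ ≤ C A³ M 𝒫 log(e + cA²𝒫/ν²)`. Search for candidate a
priori estimates; no regularity claim. [folklore] -/
theorem PalinstrophyLogBudget.static {C c : ℝ} (h : PalinstrophyLogBudget (d := d) C c)
    (hd : Fintype.card d = 3) {ν : ℝ} (hν : 0 < ν) {w : UnitAddTorus d → EuclideanSpace ℝ d}
    (hw : Torus.IsSmooth w) (hdiv : Torus.IsDivFree w) {M : ℝ} (hM : 0 ≤ M)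
    (hω : ∀ x, torusVorticitySqAt w x ≤ M ^ 2) :
    2 * palinstrophyProduction w - 2 * ν * palinstrophyDissipation w ≤
      C * M * torusPalinstrophy w * Real.log (Real.exp 1 + c * torusPalinstrophy w / ν ^ 2) := by
  obtain ⟨T, hT, u, p, hsol, hu0, -⟩ := Torus.exists_classicalNS_smooth (d := d) hd.le hν.le hw hdiv
  have h0 : (0 : ℝ) ∈ Icc 0 T := left_mem_Icc.2 hT.le
  have hder := torusPalinstrophy_hasDerivWithinAt hsol hT h0
  have hω0 : ∀ x, torusVorticitySqAt (u 0) x ≤ M ^ 2 := fun x => by rw [hu0]; exact hω x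
  have hle := h hd hν hT hsol 0 h0 M hM hω0 _ hder
  rwa [hu0] at hle

/-- **Static form of the UNLOGGED row along the amplitude ray.** If `PalinstrophyRateSupBound C`
holds on `T³`, then for every smooth divergence-free `w`, every vorticity majorant `M ≥ 0` and every
amplitude `A > 0`: `2N(w) − 2D₃(w)/A ≤ C · M · 𝒫(w)` (the row at `ν = 1`, `t = 0`, datum `A • w`:
`2A³N − 2A²D₃ ≤ C (A M) (A²𝒫)`, divided by `A³`). [folklore] -/
theorem PalinstrophyRateSupBound.static {C : ℝ} (h : PalinstrophyRateSupBound (d := d) C)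
    (hd : Fintype.card d = 3) {w : UnitAddTorus d → EuclideanSpace ℝ d}
    (hw : Torus.IsSmooth w) (hdiv : Torus.IsDivFree w) {M : ℝ} (hM : 0 ≤ M)
    (hω : ∀ x, torusVorticitySqAt w x ≤ M ^ 2) {A : ℝ} (hA : 0 < A) :
    2 * palinstrophyProduction w - 2 * palinstrophyDissipation w / A ≤
      C * M * torusPalinstrophy w := by
  have hw1 : Torus.IsContDiff 1 w := hw.isContDiff (by exact_mod_cast le_top)
  have hsm : Torus.IsSmooth (A • w) := hw.smul A
  have hdf : Torus.IsDivFree (A • w) := isDivFree_const_smul hw1 hdiv A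
  obtain ⟨T, hT, u, p, hsol, hu0, -⟩ :=
    Torus.exists_classicalNS_smooth (d := d) hd.le zero_le_one hsm hdf
  have h0 : (0 : ℝ) ∈ Icc 0 T := left_mem_Icc.2 hT.le
  have hder := torusPalinstrophy_hasDerivWithinAt hsol hT h0
  have hωA : ∀ x, torusVorticitySqAt (u 0) x ≤ (A * M) ^ 2 := fun x => by
    rw [hu0, torusVorticitySqAt_amplitude hw1 A x, mul_pow]
    exact mul_le_mul_of_nonneg_left (hω x) (sq_nonneg A)
  have hle := h hd zero_le_one hT hsol 0 h0 (A * M) (by positivity) hωA _ hder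
  rw [hu0, palinstrophyProduction_amplitude hw A, palinstrophyDissipation_amplitude hw A,
    torusPalinstrophy_amplitude hw A] at hle
  -- `hle : 2 (A³ N) − 2·1·(A² D₃) ≤ C (A M) (A² 𝒫)`; divide by `A³ > 0`
  have hA3 : 0 < A ^ 3 := by positivity
  have key : A ^ 3 * (2 * palinstrophyProduction w - 2 * palinstrophyDissipation w / A) ≤
      A ^ 3 * (C * M * torusPalinstrophy w) := by
    have e1 : A ^ 3 * (2 * palinstrophyProduction w - 2 * palinstrophyDissipation w / A) =
        2 * (A ^ 3 * palinstrophyProduction w) - 2 * 1 * (A ^ 2 * palinstrophyDissipation w) := by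
      field_simp
    have e2 : A ^ 3 * (C * M * torusPalinstrophy w) =
        C * (A * M) * (A ^ 2 * torusPalinstrophy w) := by ring
    rw [e1, e2]
    exact hle
  exact le_of_mul_le_mul_left key hA3

/-- **Dynamic ⇒ static for the unlogged row (NOGO N2, amplitude ray `A → ∞`).**
`PalinstrophyRateSupBound C → PalinstrophySupRateBound (C/2)`: from `PalinstrophyRateSupBound.static`,
`2N(w) ≤ C M 𝒫(w) + 2D₃(w)/A` for every `A > 0`, hence `N(w) ≤ (C/2) M 𝒫(w)`. [folklore] -/
theorem palinstrophySupRateBound_of_rateSupBound {C : ℝ} (h : PalinstrophyRateSupBound (d := d) C) :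
    PalinstrophySupRateBound (d := d) (C / 2) := by
  intro hd w hw hdiv M hM hω
  have key : ∀ A : ℝ, 0 < A →
      2 * palinstrophyProduction w - 2 * palinstrophyDissipation w / A ≤ C * M * torusPalinstrophy w :=
    fun A hA => h.static hd hw hdiv hM hω hA
  have hD : 0 ≤ palinstrophyDissipation w := palinstrophyDissipation_nonneg w
  show -∫ x, ⟪Torus.convect w w x, Torus.laplacian (Torus.laplacian w) x⟫ ≤ C / 2 * M * torusPalinstrophy w
  change palinstrophyProduction w ≤ C / 2 * M * torusPalinstrophy w
  by_contra hcon
  push Not at hcon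
  set ε : ℝ := palinstrophyProduction w - C / 2 * M * torusPalinstrophy w with hεdef
  have hε : 0 < ε := by rw [hεdef]; linarith
  have hA : 0 < (palinstrophyDissipation w + 1) / ε := by positivity
  have h1 := key _ hA
  have h2 : 2 * palinstrophyDissipation w / ((palinstrophyDissipation w + 1) / ε) < 2 * ε := by
    rw [div_div_eq_mul_div, div_lt_iff₀ (by positivity)]
    have : 2 * ε * (palinstrophyDissipation w + 1) - 2 * palinstrophyDissipation w * ε = 2 * ε := by
      ring
    nlinarith
  have h3 : 2 * ε = 2 * palinstrophyProduction w - C * M * torusPalinstrophy w := by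
    rw [hεdef]; ring
  linarith

/-- **The static N6 kills the dynamic row: `PalinstrophySupRateFails → PalinstrophyRateSupFails`**
(contrapositive of `palinstrophySupRateBound_of_rateSupBound` at `C/2`). [folklore] -/
theorem palinstrophyRateSupFails_of_supRateFails (h : PalinstrophySupRateFails (d := d)) :
    PalinstrophyRateSupFails (d := d) := fun C hC =>
  h (C / 2) (palinstrophySupRateBound_of_rateSupBound hC)

end Summit.NavierStokesRegularity.FunctionalMining

end
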